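import Literature.NumberTheory.EllipticCurves.CaiShuTian2014.ExplicitWaldspurger
import Literature.NumberTheory.EllipticCurves.BipartiteToricPeriod
import Literature.NumberTheory.EllipticCurves.RibetTakahashiDefinite
import HarnessLib

/-!
# C.-H. Kim 2024, Theorem 5.23 in the rank-zero LENGTH form, in the Brandt dictionary:
# `#Sel_{p^∞}(E/K) = p^{2·ord_p λ₁}` from a UNIT level-raised toric period (named fact)

Topic `Literature/NumberTheory/EllipticCurves`, story `Kim2024/` (C.-H. Kim, *A higher Gross–Zagier
formula and the structure of Selmer groups*, Trans. Amer. Math. Soc. 377 (2024), doi 10.1090/tran/9125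
= arXiv:2203.12161 [Kim2024]; PUBLISHED, refereed; held text `paper:arxiv-2203.12161`, chunk files
`pNNNN`). Sibling of `BipartiteToricPeriod.lean`, which vendors the CORANK consequence of the same
theorem (`kim_selmerCorank_baseChange_le_of_toricPeriod_ne_zero`, Mathlib-only quaternion dictionary,
for route `ToricShedding`). This file vendors the LENGTH consequence at `ord(λ^bip) = 0`, typed over the
tree's adelic Brandt package (`Brandt.XiSetup`, `Brandt.ClassSet`, `Brandt.matrix`, `Brandt.IsGrossPoint`,
`Brandt.toricPeriod` of `Automorphic/BrandtXi.lean`, `Automorphic/BrandtGrossPoints.lean`) so that it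
composes WITHOUT a bridge with Cai–Shu–Tian 2014 Thm. 1.2 (`CaiShuTian2014.thm12_trivialChar`) and
W. Zhang 2014 Thm. 6.4 (`WZhang2014.thm64_padicValNat_congruenceNumber_eq`) — requested by the cell
`bsd-ssimc` (seat `bsd-ssimc-lev`, MEMO-3 addendum B item (I1); consumer: the typed avatar
`X7.ToricPeriodUnitAt` of the X7-atom and `Supersingular/X7ToricPeriodValuation.lean`).
ONE named fact (`def … : Prop`, D-0014), nothing asserted; no `_holds` expected (bipartite Euler
systems, weak level raising, Howard's rigidity: XL).

## The printed statements (verbatim, locators in the arXiv text)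

* §2.1 *Working hypotheses* [p0005 L3–L27]: "Let `E` be a non-CM elliptic curve over `ℚ` of conductor
  `N` and `p ≥ 5` a prime such that (a) the associated mod `p` Galois representation `ρ̄` … is
  surjective, and (b) the Manin constant is prime to `p`. … Let `K` be an imaginary quadratic field of
  discriminant `D_K` such that `(D_K, Np) = 1`. Write `N = N⁺ · N⁻` where a prime divisor of `N⁺`
  splits in `K/ℚ` and a prime divisor of `N⁻` is inert in `K/ℚ`. … We always assume that (c) `N⁻` is
  square-free, (d) if `ν(N⁻)` is odd, then `E` has good reduction at `p`, and (e) if `ν(N⁻)` is odd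
  and a prime `q` satisfies `q ∣ N⁻` and `q ≡ ±1 (mod p)`, then `ρ̄` is ramified at `q`. (Condition CR)"
* §2.4 [p0005 L73–L106]: "Suppose that `ν(N⁻)` is odd. … `𝒫^adm_k = {q : q ∤ Np, q inert in K/ℚ,
  q ≢ ±1 (mod p), a_q(E) ≡ ε_q·(q+1) (mod p^k), ε_q = ±1}`, `I^adm_q = (a_q(E) − ε_q(q+1))ℤ_p` …
  `𝒩^def_k ⊆ 𝒩^adm_k`: every `n ∈ 𝒩^def_k` satisfies that `ν(nN⁻)` is odd. …
  `ord(λ^bip) = min{ν(n) : n ∈ 𝒩^def_1, λ^bip_n ≠ 0}`,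
  `∂^(i)(λ^bip) = min{j : λ^bip_n ∈ p^j ℤ_p/I^adm_n ℤ_p for every n ∈ 𝒩^def_1 with (even) ν(n) = i}`,
  `∂^(∞)(λ^bip) = min{∂^(i)(λ^bip) : i ≥ 0}`." Remark 2.1 [p0005 L109–L111]: "Our formulation of
  bipartite Euler systems works even when an elliptic curve has supersingular reduction at `p` … we do
  not use anticyclotomic Iwasawa theory at all".
* §5.2 [p0012 L107–L140, p0013 L1–L37]: `T = T_pE`, `E[p]` absolutely irreducible over `G_K`,
  **Assumption 5.20** (`E[p]` absolutely irreducible over `G_ℚ`; good reduction at `p`; CR); §5.2.2: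
  "`B_{N⁻}` the definite quaternion algebra over `ℚ` of discriminant `N⁻` and `R_{N⁺}` an Eichler order
  of `B_{N⁻}` of level `N⁺`. By using the Jacquet–Langlands correspondence, we have the corresponding
  quaternionic automorphic form `f_{N⁻} : B^×_{N⁻} \ B̂^×_{N⁻} / R̂^×_{N⁺} → ℤ_p` with normalization
  `f_{N⁻} ≢ 0 (mod p)`"; **Theorem 5.21** (weak level raising, after [BD05], [PW11], [CH15]): for
  `n ∈ 𝒩^def` "there exists a mod `I^adm_n` quaternionic `𝕋^{nN⁻}(N⁺)`-eigenform
  `f_{nN⁻} : B^×_{nN⁻} \ B̂^×_{nN⁻} / R̂^×_{N⁺} → ℤ_p/I^adm_n ℤ_p`" with `T_q ↦ a_q(f)` (`q ∤ nN`),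
  `≢ 0 (mod p)`; §5.2.3: "`λ^bip_n = Σ_{σ ∈ Gal(H/K)} f_{nN⁻}(σ · ς^(0)) ∈ ℤ_p/I^adm_n ℤ_p`", the toric
  period over `Gal(H/K) ≅ K^× \ K̂^× / 𝒪̂_K^×` (left translation through `K ↪ B`) of the Gross point
  `ς^(0)` of conductor `1` (Appendix §8).
* **Theorem 5.23** [p0013 L66–L69]: "Suppose that `λ^bip ≠ 0`. Then we have isomorphism
  `Sel(K, E[p^∞]) ≃ (ℚ_p/ℤ_p)^{⊕ ord(λ^bip)} ⊕ ⨁_{i ≥ 1} (ℤ/p^{∂^(ord+2(i−1))(λ^bip) − ∂^(ord+2i)(λ^bip)} ℤ)^{⊕2}`."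

## What is vendored (the case `ord(λ^bip) = 0` with a UNIT at some even level)

If `λ^bip_1 ≠ 0` (so `ord(λ^bip) = 0`, `∂^(0) = ord_p λ^bip_1`, `I^adm_1 = 0`) and `λ^bip_n` is a UNIT of
`ℤ_p/I^adm_n ℤ_p` for one `n ∈ 𝒩^def_1` (`ν(n) = 2s` even), then `∂^(2s)(λ^bip) = 0`, hence
`∂^(∞)(λ^bip) = 0`, and Theorem 5.23 reads `Sel(K, E[p^∞]) ≃ ⨁_{i=1}^{s} (ℤ/p^{∂^(2i−2) − ∂^(2i)})^{⊕2}`,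
a FINITE group of order `p^{2(∂^(0) − ∂^(2s))} = p^{2·ord_p λ^bip_1}` (telescoping; the exponents are the
elementary divisors, so `∂^(2i)` is non-increasing). That is the statement below:
`#Sel_{p^∞}(E/K) = p^{2·ord_p λ₁}`. (At `s = 0` it says: a unit `λ₁` gives `Sel_{p^∞}(E/K) = 0`.)

## Typing (the Brandt dictionary; cf. `CaiShuTian2014/ExplicitWaldspurger.lean` "Transcription")

* `B^×_{nN⁻} \ B̂^×_{nN⁻} / R̂^×_{N⁺}` ↔ the right class set `Brandt.ClassSet S.O` of a Brandt set-up
  `S : Brandt.XiSetup N⁺ (N⁻n)` (`S.D` definite, ramified exactly at the primes of the square-free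
  `N⁻n`; `S.O` Eichler of level `N⁺`); set-ups `S₁` of type `(N⁺, N⁻)` and `Sₙ` of type `(N⁺, N⁻n)`.
* A quaternionic eigenFORM is a FUNCTION `f : ClassSet S.O → R`; the Hecke operator `T_q` (`q ∤ nN`)
  acts on functions by `(T_q f)([I]) = Σ_{J ⊆ I, [I:J] = q²} f([J]) = Σ_i T(q)_{i,[I]} f(I_i)`, i.e. by
  `f ↦ f ᵥ* T(q)` (`Matrix.vecMul` against Voight's `T(q)_{ij} = #{J ⊆ I_j : [I_j:J] = q², [J] = [I_i]}`,
  the tree's `Brandt.matrix S.O q`; the same subideal-sum convention as the Mathlib-only sibling's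
  `IsEig`). `f_{N⁻}` ("`→ ℤ_p`, `≢ 0 mod p`", THE Jacquet–Langlands transfer): a function
  `f₁ : ClassSet S₁.O → ℤ`, `f₁ ≠ 0`, `f₁ ᵥ* T(q) = a_q(E) f₁` for all primes `q ∤ N⁺N⁻`, GENERATING
  the ℤ-module of such integral eigenfunctions (multiplicity one as a HYPOTHESIS, exactly as in the two
  siblings; then `f_{N⁻} = u·f₁` with `u ∈ ℤ_p^×`, so `ord_p λ^bip_1 = ord_p` of the toric period of
  `f₁`). `f_{nN⁻} mod p`: a function `fₙ : ClassSet Sₙ.O → ZMod p`, `fₙ ≠ 0`, `fₙ ᵥ* T(q) = a_q(E) fₙ`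
  for primes `q ∤ N⁺N⁻n`, ALONE on its eigen-line mod `p` (so `f_{nN⁻} mod 𝔪 = c·fₙ`, `c ≠ 0`; a unit
  of the local ring `ℤ_p/I^adm_n ℤ_p` is an element non-zero mod its maximal ideal `(p)`).
  `a_q(E)` = `W.LFunction q` (as in `Brandt.eigenLattice` / `BrandtModuleJLSelfPairing`).
* The Gross point of conductor `1` and its `Pic(𝒪_K)`-orbit: `ψ : K →ₐ[ℚ] S.D` with
  `Brandt.IsGrossPoint S.O ψ S.O` (an optimal embedding of `𝒪_K` into the Eichler order), orbit
  `[𝔞] ↦ hψ.act [𝔞] = [ψ(𝔞) O]`, toric period `Brandt.toricPeriod S.O ψ S.O f = Σ_{[𝔞]} f(hψ.act [𝔞])`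
  (`IsGrossPoint.toricPeriod_eq`).
* (a) `W.HasSurjectiveModNGaloisRep p`, `p ≥ 5` — forces non-CM and absolute irreducibility of `E[p]`
  over `G_ℚ` and `G_K` (index `≤ 2`), as recorded in the sibling; (b) holds by Mazur for `p ≥ 5` of good
  reduction and is not used in §5 (sibling's reading, kept); (c) `Squarefree N⁻` with `ν(N⁻)` odd;
  (d) `W.HasGoodReductionAtPrime p`; (e) CR in the Tate-curve rendering of `RibetTakahashiDefinite.lean`
  / `WZhang2014`: `q ∣ N⁻`, `q ≡ ±1 (mod p)` ⇒ `p ∤ ord_q Δ_min(E)`; `K`: `IsImaginaryQuadratic K`,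
  `(D_K, Np) = 1`, and the splitting type `(N⁺ split, N⁻ inert)` as the tree predicate
  `CaiShuTian2014.GrossWaldspurgerCondition W K N⁺ N⁻` (whose ramified clause is vacuous here) with
  `(N⁺, N⁻) = 1`; `n`: square-free, `ν(n)` even, every `q ∣ n` `1`-admissible (`q ∤ Np`, `q` inert,
  `p ∤ q² − 1`, `p ∣ a_q ∓ (q+1)`).

Reading steps recorded, not hidden (the same two as in `BipartiteToricPeriod.lean`): (i) Kim's
`f_{nN⁻}` is THE level-raised eigenform of Thm 5.21; the fact speaks of any mod-`p` eigenfunction with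
the eigenvalues `a_q(E)` alone on its eigen-line — multiplicity one is a hypothesis on the data;
(ii) Kim's `ς^(0)` is one conductor-`1` Gross point; the fact quantifies over the optimal embeddings
`(ψ, O)` — one orbit under `K̂^× ×` Atkin–Lehner (Eichler; [Gross1987, §3]; Voight §30), absorbed by
the orbit sum and by `f ∘ w = ±f` under multiplicity one, as in the sibling.
-- TODO(general form): Theorem 5.23 describes ALL of `Sel(K, E[p^∞])` (corank `ord(λ^bip)` and every
-- elementary divisor `∂^(ord+2i−2) − ∂^(ord+2i)`); only the total length at `ord = 0`, `∂^(∞) = 0` is here.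

## Text versions and published numbering (ARM P D-audit, reader bsd-cited-r10, sheet
`D-AUDIT-r10-S2.md` sha16 e834568ff3dcc1ae; typer bsd-cited-ty4, TY-QUEUE 21, 2026-08-27)

The quotations and locators above (`p0005`, `p0012`–`p0013`) are the HELD text `paper:arxiv-2203.12161`
= arXiv **v3** (6 Apr 2022), which PREDATES the journal's referee round. The post-referee text is arXiv
**v7** (12 Jan 2024, "to appear in Transactions of AMS"; e-print TeX source
`strSelmer-higher-gross-zagier-10.tex`, 1861 lines, sha16 945b976f03ff399f — read by the typer, copy
under `pub/bsd-cited/staging/bsd-cited-ty4/TYQ21/`; PDF sha16 f16b4dc77808bbde read by the reader),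
the proxy for the version of record TAMS 377 (2024), no. 5, 3691– (doi 10.1090/tran/9125, paywalled:
acq-06247, cite-only); its acknowledgement thanks "Francesc Castella for pointing out a gap in an earlier
version" and the "anonymous referee … pointing out important mistakes in earlier versions" [v7 TeX
L227–L229]. CONCORDANCE v3 → v7 (theorem counter reconstructed from the TeX source; equal to the
reader's PDF reading): §5.2 → §4.2; Assumption 5.20 → **4.21** [L1027–L1033]; Thm. 5.21 (weak level
raising) → **4.22** [L1048–L1070]; §5.2.3 (`λ^bip_n`) → **§4.2.3** [L1071–L1077]; Thm. 5.23 → **4.24**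
[L1121–L1125]; App. §8 (Gross point of conductor `1`) → **App. A** [L1783 ff.]; NEW in v7: Def. **4.16**
(free bipartite Euler system) [L881–L886], Lemma **4.25** [L1167–L1173], Thm. **4.26** [L1175–L1188],
Rem. **4.27** [L1189–L1198]. WHAT CHANGED ON THE AUDITED LINES (reader's located points F5/F6):
* §2.1 [L237–L256] now reads "… such that `(D_K, Np) = 1`, **`D_K` is odd and `≠ −3`**" [L244] and adds
  "**Hypotheses (a) and (b) also hold for the quadratic twist `E^K` of `E` by `K`.**" [L256].
* v3 Thm. 5.23 "Suppose that `λ^bip ≠ 0`. Then [the isomorphism quoted above]" became v7 **Thm. 4.24**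
  "Suppose that `(λ^{bip,(k)}, κ^{bip,(k)})` is **free for every `k ≥ 1`** and `λ^bip ≠ 0`. Then [same
  isomorphism]" [L1121–L1125], freeness = Def. 4.16 "for every `n ∈ 𝒩^ind`, there exists a free
  `R`-submodule `C_n ⊆ Sel_{𝓕(n)}(K, T)` of rank one containing `κ^bip_n`" [L881–L886] (v3's proof
  ASSERTED the needed freeness "thanks to [howard-bipartite]" [p0013 L84–L89]). The UNCONDITIONAL printed
  statement is the mod-`p^k` **Thm. 4.26**: "Let `k ≥ 1` be an integer, and `j` be an integer with
  `j ≥ 2k`. If `λ^{bip,(k),j} ≠ 0`, then we have isomorphism `Sel(K, E[p^k]) ≃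
  (ℤ/p^kℤ)^{⊕ord(λ^{bip,(k),j})} ⊕ ⨁_{i≥1}(ℤ/p^{∂^(ord+2(i−1))(λ^{bip,(k),j}) − ∂^(ord+2i)(λ^{bip,(k),j})}ℤ)^{⊕2}`
  where `ord(λ^{bip,(k),j}) = min{ν(n) : n ∈ 𝒩^def_j, λ^{bip,(k)}_n ≠ 0}` and
  `k > ∂^(ord) − ∂^(ord+2) ≥ ∂^(ord+2) − ∂^(ord+4) ≥ ⋯`" [L1175–L1188], resting on **Lemma 4.25** "For
  `j ≥ 2k`, the pair `(λ^{bip,(k),j}, κ^{bip,(k),j})` forms a free bipartite Euler system for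
  `(T/p^kT, 𝓕_cl, 𝓟^adm_j)`. Proof. See [How06, Lemma 3.3.6]" [L1167–L1173] and on Thm. 4.19
  [L1004–L1013]; `λ^{bip,(k)}_n = λ^bip_n (mod p^k)` [L1108–L1117]; `𝓟^adm_j` = primes `q ∤ Np` inert
  in `K`, `q ≢ ±1 (mod p)`, **`a_q(E) ≡ ε_q (q+1) (mod p^j)`** [L300–L305]. Rem. 4.27 (1): "… The
  standard Kolyvagin system argument does not require such a restriction if the core rank is one [MR04,
  Theorem 4.4.1]. We expect that a similar result should exist for bipartite Euler systems and will
  investigate this aspect in a near future." [L1189–L1193]. CONSEQUENCE: flag `K24-Thm523-free@v3`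
  on `thm523_…` below; its print-covered DEPTH twin `thm426_…_deepAdmissible` + bridge at the end.

## References

* [Kim2024] C.-H. Kim, Trans. AMS 377 (2024), no. 5, doi 10.1090/tran/9125 = arXiv:2203.12161: held v3
  numbering §2.1, §2.4, Rem. 2.1, §5.2 (Ass. 5.20, Thm. 5.21, §5.2.3), Thm. 5.23, App. §8 = published
  (v7) §2.1, §2.4, §4.2 (Ass. 4.21, Thm. 4.22, §4.2.3), Thm. 4.24 / Lemma 4.25 / Thm. 4.26 / Rem. 4.27, App. A.
* [Howard2006Bipartite] J. reine angew. Math. 597 (2006), Lemma 3.3.6; [BertoliniDarmon2005] Ann. of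
  Math. 162; [PollackWeston2011] Compos. Math. 147 §2.1; [Gross1987] §§3, 11.
-/

noncomputable section

open scoped Matrix

open NumberField WeierstrassCurve Literature.NumberTheory.Automorphic
  Literature.NumberTheory.EllipticCurves.CaiShuTian2014

namespace Literature.NumberTheory.EllipticCurves.Kim2024

/-- **C.-H. Kim 2024, Theorem 5.23 at `ord(λ^bip) = 0` with a unit at an even level (LENGTH form):
`#Sel_{p^∞}(E/K) = p^{2·ord_p λ₁}`.** Binders (module docstring for the dictionary and the verbatim
source): curve side — `W` a global minimal model of `E/ℚ`, `p ≥ 5` with `ρ̄_{E,p}` onto (§2.1 (a)) and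
good reduction at `p` ((d)); `K` imaginary quadratic with `(D_K, Np) = 1`, `N = N⁺N⁻` with
`(N⁺, N⁻) = 1`, `N⁺`-primes split, `N⁻`-primes inert (`GrossWaldspurgerCondition`), `N⁻` square-free
with `ν(N⁻)` odd ((c), §2.4), Condition CR ((e), Tate-curve rendering); `n` square-free with `ν(n)`
even, every prime `q ∣ n` `1`-admissible. Quaternionic side — `S₁`, `Sₙ` Brandt set-ups of types
`(N⁺, N⁻)`, `(N⁺, N⁻n)`; `f₁ : Cls(S₁.O) → ℤ` a non-zero `T_q`-eigenfunction (`f ᵥ* T(q) = a_q f`,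
`q ∤ N⁺N⁻`) generating the integral eigenfunctions (= Kim's `f_{N⁻}` up to `ℤ_p^×`);
`fₙ : Cls(Sₙ.O) → ZMod p` a non-zero mod-`p` `T_q`-eigenfunction (`q ∤ N⁺N⁻n`) alone on its eigen-line
(= Kim's `f_{nN⁻} mod p` up to `𝔽_p^×`); `ψ₁`, `ψₙ` optimal embeddings of `𝓞_K` (Gross points of
conductor `1`). CONCLUSION: if the toric period `λ₁ = Σ_{[𝔞]} f₁([ψ₁(𝔞)O])` is non-zero and the toric
period of `fₙ` is non-zero in `ZMod p` (i.e. `λ^bip_n` is a unit), then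
`Nat.card (Sel_{p^∞}(E/K)) = p ^ (2·ord_p λ₁)` — Theorem 5.23 with `ord(λ^bip) = 0`, `∂^(0) = ord_p λ₁`,
`∂^(ν(n)) = ∂^(∞) = 0`. Size XL; PUBLISHED; no `_holds`.
**FLAG `K24-Thm523-free@v3`** (INFORMATIONAL — NOT a statement change; ARM P D-audit, reader
bsd-cited-r10, sheet `D-AUDIT-r10-S2.md` sha16 e834568ff3dcc1ae §B B15 / §D F5–F6 «VERBATIM (weaker)
w.r.t. the SUPERSEDED arXiv v3 Thm. 5.23; STRONGER-THAN-PRINT w.r.t. v7 Thm. 4.24»; lead ruling (79) =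
TY-QUEUE 21, typer bsd-cited-ty4, 2026-08-27; the C2 desk prices the flag): typed from the PRE-REFEREE
held text (arXiv v3). In the published text (arXiv v7 = TAMS 377 (2024); module docstring "Text
versions") the theorem is **Thm. 4.24** and ASSUMES the mod-`p^k` systems `(λ^{bip,(k)}, κ^{bip,(k)})`
FREE for every `k ≥ 1` (Def. 4.16) [v7 TeX L1121–L1125, L881–L886] — a hypothesis this declaration
does not carry (nor v7 §2.1's "`D_K` odd and `≠ −3`" [L244]); v3's proof asserted that freeness
[p0013 L84–L89]; removing it is OPEN per the author (Rem. 4.27 (1) [L1189–L1193]). UNCONDITIONAL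
printed cover = Thm. 4.26 with Lemma 4.25 at levels in `𝒩^def_j`, `j ≥ 2k` [L1166–L1188]: the case
vendored here (`ord(λ^bip) = 0`, a UNIT `λ^bip_n` at ONE level `n`) is reached with
`k = ord_p λ₁ + 1`, `j = 2k` EXACTLY when every `q ∣ n` is `2(ord_p λ₁ + 1)`-admissible, which the
`1`-admissibility binder below does not give (the sub-case `λ₁` a unit, `n = 1`, is covered).
PRINT-COVERED TWIN (below): `thm426_natCard_selmerGroupPInfty_eq_pow_of_unitToricPeriod_deepAdmissible`
(admissibility depth `2(ord_p λ₁ + 1)` + the two v7 `K`-binders; bridge `…_deepAdmissible_of_thm523`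
PROVED ⇒ a NARROWING). CONSUMERS of THIS decl (hypothesis `hKim`; "types the X7 r0 object, closes
NONE"): `Summits/…/Rank1Residual/Supersingular/X7ToricPeriodUnit{,Class,Consumer,MainConjecture,
Tamagawa}.lean` — `X7.ToricPeriodUnitData.admissible` asks `1`-admissible primes with `λ₁` of
arbitrary valuation (the flagged configuration; re-pointing is the owning planner's call, sheet §C.3);
the sibling `kim_selmerCorank_baseChange_le_of_toricPeriod_ne_zero` (`BipartiteToricPeriod.lean`,
`(2M)`-admissible) is flag-free. RETIREMENT: a refereed structure theorem without the `j ≥ 2k`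
restriction, or consumers re-pointed to the twin. This declaration is KEPT byte-identical.
[cite: Kim2024, Thm. 5.23 with §2.1 (a)(c)(d)(e), §2.4, Thm. 5.21, §5.2.3 (arXiv:2203.12161 p0005, p0012–p0013)] -/
def thm523_natCard_selmerGroupPInfty_eq_pow_of_unitToricPeriod : Prop :=
  ∀ (W : WeierstrassCurve ℚ) [W.IsElliptic] [W.IsGloballyMinimal] (p : ℕ) [Fact p.Prime]
    (K : Type) [Field K] [NumberField K] (Nplus Nminus n : ℕ)
    (S₁ : Brandt.XiSetup Nplus Nminus) [Fintype (Brandt.ClassSet S₁.O)]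
    (Sₙ : Brandt.XiSetup Nplus (Nminus * n)) [Fintype (Brandt.ClassSet Sₙ.O)]
    (ψ₁ : K →ₐ[ℚ] S₁.D) (hψ₁ : Brandt.IsGrossPoint S₁.O ψ₁ S₁.O)
    (ψₙ : K →ₐ[ℚ] Sₙ.D) (_hψₙ : Brandt.IsGrossPoint Sₙ.O ψₙ Sₙ.O)
    (f₁ : Brandt.ClassSet S₁.O → ℤ) (fₙ : Brandt.ClassSet Sₙ.O → ZMod p),
    -- §2.1 (a), (d): `p ≥ 5`, `ρ̄_{E,p}` surjective, good reduction at `p`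
    5 ≤ p → W.HasSurjectiveModNGaloisRep (p : ℤ) → W.HasGoodReductionAtPrime p →
    -- `K` imaginary quadratic, `(D_K, Np) = 1`, `N = N⁺N⁻`, `N⁺` split, `N⁻` inert; (c) and `ν(N⁻)` odd
    IsImaginaryQuadratic K → Int.gcd (NumberField.discr K) (W.conductorNorm ℤ * p) = 1 →
    GrossWaldspurgerCondition W K Nplus Nminus → Nat.Coprime Nplus Nminus →
    Squarefree Nminus → Odd Nminus.primeFactors.card →
    -- (e) Condition CR (Tate curve: `ρ̄` ramified at multiplicative `q` iff `p ∤ ord_q Δ_min`)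
    (∀ q ∈ Nminus.primeFactors, ((q : ZMod p) = 1 ∨ (q : ZMod p) = -1) →
      ¬ p ∣ (W.minimalDiscriminantNorm ℤ).factorization q) →
    -- `n ∈ 𝒩^def_1`: square-free, `ν(n)` even, every `q ∣ n` is `1`-admissible
    Squarefree n → Even n.primeFactors.card →
    (∀ q ∈ n.primeFactors, ¬ q ∣ Nplus * Nminus * p ∧
      (((Ideal.span {(q : ℤ)}).primesOver (𝓞 K)).ncard ≠ 2 ∧ ¬ (q : ℤ) ∣ NumberField.discr K) ∧
      ¬ (p : ℤ) ∣ (q : ℤ) ^ 2 - 1 ∧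
      ((p : ℤ) ∣ W.LFunction q - (q + 1) ∨ (p : ℤ) ∣ W.LFunction q + (q + 1))) →
    -- `f_{N⁻}`: non-zero integral eigenfunction generating the integral eigenfunctions
    f₁ ≠ 0 →
    (∀ q : ℕ, q.Prime → ¬ q ∣ Nplus * Nminus → f₁ ᵥ* Brandt.matrix S₁.O q = (W.LFunction q) • f₁) →
    (∀ g : Brandt.ClassSet S₁.O → ℤ,
      (∀ q : ℕ, q.Prime → ¬ q ∣ Nplus * Nminus → g ᵥ* Brandt.matrix S₁.O q = (W.LFunction q) • g) →
      ∃ c : ℤ, g = c • f₁) →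
    -- `f_{nN⁻} mod p`: non-zero mod-`p` eigenfunction, alone on its eigen-line
    fₙ ≠ 0 →
    (∀ q : ℕ, q.Prime → ¬ q ∣ Nplus * Nminus * n →
      fₙ ᵥ* (Brandt.matrix Sₙ.O q).map (Int.cast : ℤ → ZMod p) = ((W.LFunction q : ℤ) : ZMod p) • fₙ) →
    (∀ g : Brandt.ClassSet Sₙ.O → ZMod p,
      (∀ q : ℕ, q.Prime → ¬ q ∣ Nplus * Nminus * n →
        g ᵥ* (Brandt.matrix Sₙ.O q).map (Int.cast : ℤ → ZMod p) = ((W.LFunction q : ℤ) : ZMod p) • g) →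
      ∃ c : ZMod p, g = c • fₙ) →
    -- `λ^bip_1 ≠ 0` and `λ^bip_n` a unit
    Brandt.toricPeriod S₁.O ψ₁ S₁.O f₁ ≠ 0 →
    Brandt.toricPeriod Sₙ.O ψₙ Sₙ.O fₙ ≠ 0 →
    Nat.card ((W.baseChange K).selmerGroupPInfty p) =
      p ^ (2 * padicValInt p (Brandt.toricPeriod S₁.O ψ₁ S₁.O f₁))

/-- **Finiteness** (PROVED from the fact): under the hypotheses of
`thm523_natCard_selmerGroupPInfty_eq_pow_of_unitToricPeriod`, `Sel_{p^∞}(E/K)` is finite (its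
cardinality is a power of `p`, in particular non-zero). [cite: Kim2024, Thm. 5.23 (ord(λ^bip) = 0)] -/
theorem finite_selmerGroupPInfty_of_thm523
    (h : thm523_natCard_selmerGroupPInfty_eq_pow_of_unitToricPeriod)
    (W : WeierstrassCurve ℚ) [W.IsElliptic] [W.IsGloballyMinimal] (p : ℕ) [Fact p.Prime]
    (K : Type) [Field K] [NumberField K] (Nplus Nminus n : ℕ)
    (S₁ : Brandt.XiSetup Nplus Nminus) [Fintype (Brandt.ClassSet S₁.O)]
    (Sₙ : Brandt.XiSetup Nplus (Nminus * n)) [Fintype (Brandt.ClassSet Sₙ.O)]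
    (ψ₁ : K →ₐ[ℚ] S₁.D) (hψ₁ : Brandt.IsGrossPoint S₁.O ψ₁ S₁.O)
    (ψₙ : K →ₐ[ℚ] Sₙ.D) (hψₙ : Brandt.IsGrossPoint Sₙ.O ψₙ Sₙ.O)
    (f₁ : Brandt.ClassSet S₁.O → ℤ) (fₙ : Brandt.ClassSet Sₙ.O → ZMod p)
    (hp5 : 5 ≤ p) (hsurj : W.HasSurjectiveModNGaloisRep (p : ℤ)) (hgood : W.HasGoodReductionAtPrime p)
    (hK : IsImaginaryQuadratic K) (hDK : Int.gcd (NumberField.discr K) (W.conductorNorm ℤ * p) = 1)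
    (hGW : GrossWaldspurgerCondition W K Nplus Nminus) (hcop : Nat.Coprime Nplus Nminus)
    (hsq : Squarefree Nminus) (hodd : Odd Nminus.primeFactors.card)
    (hCR : ∀ q ∈ Nminus.primeFactors, ((q : ZMod p) = 1 ∨ (q : ZMod p) = -1) →
      ¬ p ∣ (W.minimalDiscriminantNorm ℤ).factorization q)
    (hn : Squarefree n) (hν : Even n.primeFactors.card)
    (hadm : ∀ q ∈ n.primeFactors, ¬ q ∣ Nplus * Nminus * p ∧
      (((Ideal.span {(q : ℤ)}).primesOver (𝓞 K)).ncard ≠ 2 ∧ ¬ (q : ℤ) ∣ NumberField.discr K) ∧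
      ¬ (p : ℤ) ∣ (q : ℤ) ^ 2 - 1 ∧
      ((p : ℤ) ∣ W.LFunction q - (q + 1) ∨ (p : ℤ) ∣ W.LFunction q + (q + 1)))
    (hf₁0 : f₁ ≠ 0)
    (hf₁ : ∀ q : ℕ, q.Prime → ¬ q ∣ Nplus * Nminus → f₁ ᵥ* Brandt.matrix S₁.O q = (W.LFunction q) • f₁)
    (hf₁gen : ∀ g : Brandt.ClassSet S₁.O → ℤ,
      (∀ q : ℕ, q.Prime → ¬ q ∣ Nplus * Nminus → g ᵥ* Brandt.matrix S₁.O q = (W.LFunction q) • g) →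
      ∃ c : ℤ, g = c • f₁)
    (hfₙ0 : fₙ ≠ 0)
    (hfₙ : ∀ q : ℕ, q.Prime → ¬ q ∣ Nplus * Nminus * n →
      fₙ ᵥ* (Brandt.matrix Sₙ.O q).map (Int.cast : ℤ → ZMod p) = ((W.LFunction q : ℤ) : ZMod p) • fₙ)
    (hfₙone : ∀ g : Brandt.ClassSet Sₙ.O → ZMod p,
      (∀ q : ℕ, q.Prime → ¬ q ∣ Nplus * Nminus * n →
        g ᵥ* (Brandt.matrix Sₙ.O q).map (Int.cast : ℤ → ZMod p) = ((W.LFunction q : ℤ) : ZMod p) • g) →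
      ∃ c : ZMod p, g = c • fₙ)
    (hlam1 : Brandt.toricPeriod S₁.O ψ₁ S₁.O f₁ ≠ 0)
    (hlamn : Brandt.toricPeriod Sₙ.O ψₙ Sₙ.O fₙ ≠ 0) :
    Finite ((W.baseChange K).selmerGroupPInfty p) := by
  have hcard := h W p K Nplus Nminus n S₁ Sₙ ψ₁ hψ₁ ψₙ hψₙ f₁ fₙ hp5 hsurj hgood hK hDK hGW hcop hsq hodd
    hCR hn hν hadm hf₁0 hf₁ hf₁gen hfₙ0 hfₙ hfₙone hlam1 hlamn
  have hp : p.Prime := Fact.out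
  have hne : Nat.card ((W.baseChange K).selmerGroupPInfty p) ≠ 0 := by
    rw [hcard]; exact pow_ne_zero _ hp.ne_zero
  exact Nat.finite_of_card_ne_zero hne

/-!
## The print-covered DEPTH twin (published text, arXiv v7 = TAMS 377: Thm. 4.26 with Lemma 4.25)

ARM P TY-QUEUE 21 (lead ruling (79); reader bsd-cited-r10 sheet e834568ff3dcc1ae §D F5/F6, kernel
seed `D-AUDIT-r10-S2-check.lean` 1079694e63832f75 K6; typer bsd-cited-ty4, 2026-08-27): ONE new named
fact (the twin) + the bridge old ⇒ twin (proved); the two declarations above are byte-identical.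
WHY THE TWIN IS COVERED BY PRINT (v7 TeX locators; module docstring "Text versions"). Data: `λ₁ =
λ^bip_1 ≠ 0` (so `ord = 0`; `1 ∈ 𝒩^def_j` for every `j`), `v := ord_p λ₁`, `k := v + 1`, `j := 2k`,
and ONE level `n ∈ 𝒩^def_j` (square-free, `ν(n)` even, every `q ∣ n` `j`-admissible [L300–L312,
L678]) at which `λ^bip_n` is a unit. Then `λ^{bip,(k)}_1 = λ₁ (mod p^k) ≠ 0` (`v < k`), so Thm. 4.26
[L1175–L1188] applies (its freeness input is Lemma 4.25 = [How06, 3.3.6] [L1167–L1173], no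
hypothesis): `ord(λ^{bip,(k),j}) = 0`, `∂^(0) = ord_p(λ₁ mod p^k) = v`, `∂^(ν(n)) = 0` (the unit);
the exponents being the elementary divisors `d_1 ≥ d_2 ≥ ⋯` of Thm. 4.19 [L1004–L1013]
(`∂^(2s) = min{k, δ + Σ_{i ≥ s+1} d_i}`), `Sel(K, E[p^k]) ≃ ⨁_{i ≤ ν(n)/2} (ℤ/p^{d_i}ℤ)^{⊕2}` with
`Σ d_i = v`, every `d_i ≤ v < k` (so Thm. 4.26's side condition `k > ∂^(0) − ∂^(2) ≥ ⋯` holds). Two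
ELEMENTARY steps finish: (i) `Sel(K, E[p^k]) ≃ Sel(K, E[p^∞])[p^k]`, displayed by the print in the
proof of Thm. 4.24 ("For `k > 0`, we have `Sel(K, E[p^k]) ≃ (ℤ/p^kℤ)^{⊕r} ⊕ ⨁_{i ≥ r+1}
(ℤ/p^{min{k, e_i}}ℤ)^{⊕2}`" [L1131–L1135]; `E(K)[p] = 0` since `E[p]` is absolutely irreducible over
`G_K` [L1022], from (a) and `p ≥ 5`); (ii) a `ℤ_p`-torsion module whose `p^k`-torsion is killed by
`p^{k−1}` equals its `p^k`-torsion, so `Sel(K, E[p^∞])` is FINITE of order `p^{2v}` — the conclusion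
`Nat.card (Sel_{p^∞}(E/K)) = p^(2·ord_p λ₁)` below, the SAME as the v3-typed fact's, under the deeper
certificate. Label offered to the C2 desk: VERBATIM-COMPOSITE (weaker) w.r.t. v7 Thm. 4.26 ∘ (i) ∘ (ii).
v7 §2.1 STANDING HYPOTHESES on the twin [L237–L256]: (a) `ρ̄_{E,p}` onto, `p ≥ 5` — binder; (b) Manin
constant prime to `p` — NOT a binder, exactly as in the fact above and its sibling (`f_{N⁻}` is
normalised `≢ 0 (mod p)` on the §4 path [L1037–L1039]; the printed sufficient condition "holds if `E`
has semi-stable reduction at `p` [Maz78, Cor. 4.1]" [L242] is met at the good prime `p ∤ N·D_K` for the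
optimal curves isogenous to `E`, `E^K`, prime-to-`p` isogeny under (a)); "`D_K` odd and `≠ −3`" [L244]
— TWO NEW BINDERS `Odd (discr K)`, `discr K ≠ −3` (typed literally; App. A itself treats both parities
[L1790–L1792]; reader F6); (c)(d)(e), `(D_K, Np) = 1`, `N = N⁺N⁻` — binders as above; "(a) and (b)
also hold for `E^K`" [L256]: (a) for `E^K` FOLLOWS from (a) for `E` at `p ≥ 5` (`ρ̄_{E,p} ⊗ χ_K` has
the same derived image `SL₂(𝔽_p)` and cyclotomic determinant) — no binder; (b) for `E^K` as (b). -/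

/-- **C.-H. Kim 2024, published Thm. 4.26 (with Lemma 4.25) at `ord(λ^bip) = 0` with a unit at ONE
`2(ord_p λ₁ + 1)`-admissible level of even length (LENGTH form): `#Sel_{p^∞}(E/K) = p^{2·ord_p λ₁}`** —
the print-covered DEPTH twin of `thm523_natCard_selmerGroupPInfty_eq_pow_of_unitToricPeriod` (ARM P
TY-QUEUE 21; reader r10 sheet e834568ff3dcc1ae §D F5/F6, kernel K6; derivation from v7 Thm. 4.26 in
the section docstring above). Binders = those of the v3-typed fact, byte for byte, EXCEPT: (1) after `IsImaginaryQuadratic K`, the two v7 §2.1 binders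
`Odd (NumberField.discr K)` and `NumberField.discr K ≠ -3` [v7 TeX L244]; (2) the admissibility clause
of the primes `q ∣ n`: `p ∣ a_q ∓ (q+1)` (`n ∈ 𝒩^def_1`) becomes `p^{2(ord_p λ₁ + 1)} ∣ a_q ∓ (q+1)`
(`n ∈ 𝒩^def_j`, `j = 2k`, `k = ord_p λ₁ + 1` [L300–L312, L1113–L1117, L1166–L1176]), where
`λ₁ = Brandt.toricPeriod S₁.O ψ₁ S₁.O f₁ ∈ ℤ` (= Kim's `λ^bip_1` up to `ℤ_p^×`, so `ord_p` agrees).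
CONCLUSION unchanged: `Nat.card (Sel_{p^∞}(E/K)) = p ^ (2·ord_p λ₁)`. Weaker than the fact above
(bridge `…_deepAdmissible_of_thm523`, proved); flag-free w.r.t. v7. Size XL; PUBLISHED; no `_holds`.
[cite: Kim2024, Thm. 4.26 with Lemma 4.25 and Thm. 4.19, §2.1 (a)(c)(d)(e) + "D_K odd, ≠ −3", §2.4, Assumption 4.21, Thm. 4.22, §4.2.3, App. A (published numbering = arXiv:2203.12161v7 TeX L237–L256, L298–L331, L1004–L1013, L1027–L1077, L1106–L1117, L1166–L1188; TAMS 377 (2024) no. 5, VoR pages pending acq-06247)]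
[cite: Howard2006Bipartite, Lemma 3.3.6] -/
def thm426_natCard_selmerGroupPInfty_eq_pow_of_unitToricPeriod_deepAdmissible : Prop :=
  ∀ (W : WeierstrassCurve ℚ) [W.IsElliptic] [W.IsGloballyMinimal] (p : ℕ) [Fact p.Prime]
    (K : Type) [Field K] [NumberField K] (Nplus Nminus n : ℕ)
    (S₁ : Brandt.XiSetup Nplus Nminus) [Fintype (Brandt.ClassSet S₁.O)]
    (Sₙ : Brandt.XiSetup Nplus (Nminus * n)) [Fintype (Brandt.ClassSet Sₙ.O)]
    (ψ₁ : K →ₐ[ℚ] S₁.D) (hψ₁ : Brandt.IsGrossPoint S₁.O ψ₁ S₁.O)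
    (ψₙ : K →ₐ[ℚ] Sₙ.D) (_hψₙ : Brandt.IsGrossPoint Sₙ.O ψₙ Sₙ.O)
    (f₁ : Brandt.ClassSet S₁.O → ℤ) (fₙ : Brandt.ClassSet Sₙ.O → ZMod p),
    -- §2.1 (a), (d): `p ≥ 5`, `ρ̄_{E,p}` surjective, good reduction at `p`
    5 ≤ p → W.HasSurjectiveModNGaloisRep (p : ℤ) → W.HasGoodReductionAtPrime p →
    -- `K` imaginary quadratic with `D_K` ODD and `≠ -3` (v7 §2.1), `(D_K, Np) = 1`, `N = N⁺N⁻`,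
    -- `N⁺` split, `N⁻` inert; (c) and `ν(N⁻)` odd
    IsImaginaryQuadratic K → Odd (NumberField.discr K) → NumberField.discr K ≠ -3 →
    Int.gcd (NumberField.discr K) (W.conductorNorm ℤ * p) = 1 →
    GrossWaldspurgerCondition W K Nplus Nminus → Nat.Coprime Nplus Nminus →
    Squarefree Nminus → Odd Nminus.primeFactors.card →
    -- (e) Condition CR (Tate curve: `ρ̄` ramified at multiplicative `q` iff `p ∤ ord_q Δ_min`)
    (∀ q ∈ Nminus.primeFactors, ((q : ZMod p) = 1 ∨ (q : ZMod p) = -1) →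
      ¬ p ∣ (W.minimalDiscriminantNorm ℤ).factorization q) →
    -- `n ∈ 𝒩^def_j`, `j = 2(ord_p λ₁ + 1)`: square-free, `ν(n)` even, every `q ∣ n` `j`-admissible
    Squarefree n → Even n.primeFactors.card →
    (∀ q ∈ n.primeFactors, ¬ q ∣ Nplus * Nminus * p ∧
      (((Ideal.span {(q : ℤ)}).primesOver (𝓞 K)).ncard ≠ 2 ∧ ¬ (q : ℤ) ∣ NumberField.discr K) ∧
      ¬ (p : ℤ) ∣ (q : ℤ) ^ 2 - 1 ∧
      ((p : ℤ) ^ (2 * (padicValInt p (Brandt.toricPeriod S₁.O ψ₁ S₁.O f₁) + 1)) ∣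
          W.LFunction q - (q + 1) ∨
        (p : ℤ) ^ (2 * (padicValInt p (Brandt.toricPeriod S₁.O ψ₁ S₁.O f₁) + 1)) ∣
          W.LFunction q + (q + 1))) →
    -- `f_{N⁻}`: non-zero integral eigenfunction generating the integral eigenfunctions
    f₁ ≠ 0 →
    (∀ q : ℕ, q.Prime → ¬ q ∣ Nplus * Nminus → f₁ ᵥ* Brandt.matrix S₁.O q = (W.LFunction q) • f₁) →
    (∀ g : Brandt.ClassSet S₁.O → ℤ,
      (∀ q : ℕ, q.Prime → ¬ q ∣ Nplus * Nminus → g ᵥ* Brandt.matrix S₁.O q = (W.LFunction q) • g) →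
      ∃ c : ℤ, g = c • f₁) →
    -- `f_{nN⁻} mod p`: non-zero mod-`p` eigenfunction, alone on its eigen-line
    fₙ ≠ 0 →
    (∀ q : ℕ, q.Prime → ¬ q ∣ Nplus * Nminus * n →
      fₙ ᵥ* (Brandt.matrix Sₙ.O q).map (Int.cast : ℤ → ZMod p) = ((W.LFunction q : ℤ) : ZMod p) • fₙ) →
    (∀ g : Brandt.ClassSet Sₙ.O → ZMod p,
      (∀ q : ℕ, q.Prime → ¬ q ∣ Nplus * Nminus * n →
        g ᵥ* (Brandt.matrix Sₙ.O q).map (Int.cast : ℤ → ZMod p) = ((W.LFunction q : ℤ) : ZMod p) • g) →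
      ∃ c : ZMod p, g = c • fₙ) →
    -- `λ^bip_1 ≠ 0` and `λ^bip_n` a unit
    Brandt.toricPeriod S₁.O ψ₁ S₁.O f₁ ≠ 0 →
    Brandt.toricPeriod Sₙ.O ψₙ Sₙ.O fₙ ≠ 0 →
    Nat.card ((W.baseChange K).selmerGroupPInfty p) =
      p ^ (2 * padicValInt p (Brandt.toricPeriod S₁.O ψ₁ S₁.O f₁))

/-- **Bridge, PROVED: the v3-typed fact implies its depth twin** (a `j`-admissible prime is
`1`-admissible, `p ∣ p^j`; the two extra `K`-binders are discarded): the twin is a NARROWING of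
`thm523_natCard_selmerGroupPInfty_eq_pow_of_unitToricPeriod`; deep-certificate consumers re-point at
no cost. [cite: Kim2024, Thm. 4.26 (arXiv:2203.12161v7 TeX L1175–L1188)] -/
theorem thm426_natCard_selmerGroupPInfty_eq_pow_of_unitToricPeriod_deepAdmissible_of_thm523
    (h : thm523_natCard_selmerGroupPInfty_eq_pow_of_unitToricPeriod) :
    thm426_natCard_selmerGroupPInfty_eq_pow_of_unitToricPeriod_deepAdmissible := by
  intro W _ _ p _ K _ _ Nplus Nminus n S₁ _ Sₙ _ ψ₁ hψ₁ ψₙ hψₙ f₁ fₙ hp hsurj hgood hK _ _ hDK hGW hcop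
    hsq hodd hCR hn hν hadm hf₁0 hf₁ hf₁gen hfₙ0 hfₙ hfₙone hlam1 hlamn
  refine h W p K Nplus Nminus n S₁ Sₙ ψ₁ hψ₁ ψₙ hψₙ f₁ fₙ hp hsurj hgood hK hDK hGW hcop hsq hodd hCR
    hn hν ?_ hf₁0 hf₁ hf₁gen hfₙ0 hfₙ hfₙone hlam1 hlamn
  intro q hq
  obtain ⟨h1, h2, h3, h4⟩ := hadm q hq
  have hpow : (p : ℤ) ∣
      (p : ℤ) ^ (2 * (padicValInt p (Brandt.toricPeriod S₁.O ψ₁ S₁.O f₁) + 1)) :=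
    dvd_pow_self (p : ℤ) (by omega)
  exact ⟨h1, h2, h3, h4.imp hpow.trans hpow.trans⟩

end Literature.NumberTheory.EllipticCurves.Kim2024

end
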